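/-
Copyright: statement-level skeleton of a published paper (lit-balaban cell, Phase-2 proof seat p39 gen 3). No proof claims
beyond what the kernel checks below.
-/
import Mathlib.Analysis.Calculus.SmoothSeries
import Mathlib.MeasureTheory.Integral.IntegralEqImproper
import Mathlib.MeasureTheory.Integral.ExpDecay
import Literature.MathematicalPhysics.QuantumFieldTheory.Balaban1983to89.B3CxiBesselKernel
import Literature.MathematicalPhysics.QuantumFieldTheory.Balaban1983to89.B3CxiPropagator

/-!
# B3 — T. Bałaban, *(Higgs)₂,₃ quantum fields in a finite volume. III. Renormalization*, CMP **88** (1983) 411–445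
[Balaban1983Higgs3], p. 437: towards the printed bound |C^ξ(y−y′)| ≤ O(1)e^{−½|y−y′|}/|y−y′| — FILE 2/3: POISSONIZATION AND
SEPARATION OF VARIABLES, C^ξ(y) = θξ²ξ^{−d}∫₀^∞ e^{−t} Π_μ F(θt, |y_μ|) dt

statement-level skeleton of published theorems with citation tags; proofs where landed; nothing here is a claim about
the Yang–Mills mass gap

PDF held: `paper:balaban1983-higgs-2-3-quantum-fields-finite-volume` (journal page = PDF page + 410), p. 437 [PDF 27].
WHAT IS REPRODUCED: the second of three files for row **B3.Eq3.11-3.17** of `HOME/lit-balaban-r15/ROWS-B3.md` (reader/typer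
r15, fold owner of B3) — the p. 437 sentence *"Using the inequalities |C^ξ(y − y′)| ≦ O(1)e^{−½|y−y′|}/|y − y′|, … we can
estimate (3.16) by a constant"*; unit `lit-balaban-p39-g3` (Phase-2 proof seat p39, gen 3), HOME `run/shared/lean/pub/lit-balaban/`.
The free propagator C^ξ = (−Δ^ξ+1)^{−1} on ξℤ^d is in the tree as r15's momentum integral `B3Sect3VectorSelfEnergy.Cxi d ξ y`,
identified with the position-space Neumann series in `B3CxiPropagator` (`Cxi_eq_neumannK`, fixed-point equation
`neumannK_fixedPoint` C = θ·HC + θξ²·ξ^{−d}δ₀ with θ = `hopWeight d ξ` = (2d+ξ²)^{−1} and H = `hop` the nearest-neighbour sum,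
uniqueness of bounded solutions `eq_zero_of_hop_fixedPoint`).  THIS FILE proves the POISSONIZATION / SEPARATION-OF-VARIABLES
FORMULA (main theorems `Cxi_eq_poissonK`, `Cxi_eq_integral`):
**C^ξ(y) = θξ²ξ^{−d} ∫₀^∞ e^{−t} Π_{μ<d} F(θt, |y_μ|) dt  (0 < ξ, y ∈ ℤ^d)**, F = `B3CxiBesselKernel.besselF` the
one-dimensional kernel F(s,n) = Σ_j s^j/j!·s^{j+n}/(j+n)! (= I_n(2s)).  Route (no walk combinatorics): §1 F(·,n) is
differentiable with F′(s,n) = F(s,n+1) + F(s,|n−1|) (termwise differentiation of the series with a dominated termwise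
derivative, Mathlib `hasDerivAt_tsum_of_isPreconnected`); §2 the separated kernel
Q(s)(y) = Π_μ F(s,|y_μ|) satisfies the lattice heat equation dQ/ds = HQ (`hasDerivAt_Q`) with Q(0) = δ₀ and
0 ≤ Q(s) ≤ e^{2ds}; §3 the Poissonized kernel K(y) = θξ²ξ^{−d}∫₀^∞e^{−t}Q(θt)(y)dt is bounded and, integrating
d/dt[e^{−t}Q(θt)(y)] = e^{−t}(θ(HQ(θt))(y) − Q(θt)(y)) over (0,∞) (`MeasureTheory.integral_Ioi_of_hasDerivAt_of_tendsto'`,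
decay e^{−t}Q(θt) ≤ e^{−θξ²t} from 1 − 2dθ = θξ²), satisfies the same fixed-point equation K = θ·HK + θξ²ξ^{−d}δ₀
(`poissonK_fixedPoint`); §4 hence C^ξ − K is a bounded solution of the homogeneous equation and vanishes by r15's uniqueness
theorem.  File 3 (`B3CxiUniformBound`) inserts the tilted Poisson bound `B3CxiBesselKernel.besselF_le` into this integral to get
the printed bound uniformly in 0 < ξ ≤ 1 for d = 3.  Mathlib + the two cited tree files only; definitions with bodies
(`expTerm`, `dExpTerm`, `dBesselTerm`, `G`, `Q`, `integrand`, `poissonK`); no named facts.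
-/

open scoped BigOperators Topology
open Real MeasureTheory Set Filter

namespace Literature.MathematicalPhysics.QuantumFieldTheory.Balaban1983to89.B3CxiPoissonization

open B3Sect3VectorSelfEnergy B3CxiPropagator B3CxiBesselKernel

noncomputable section

variable {d : ℕ} {ξ : ℝ}

/-! ## 1. The Bessel kernel is differentiable in s with dF(s,n)/ds = F(s,n+1) + F(s,n−1) (F(s,−1) := F(s,1)) -/

/-- e_k(s) = s^k/k!. [cite: Balaban1983Higgs3, (3.16) p.437] -/
def expTerm (s : ℝ) (k : ℕ) : ℝ := s ^ k / k.factorial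

/-- kernel: e_k ≥ 0 for s ≥ 0. [cite: Balaban1983Higgs3, (3.16) p.437] -/
theorem expTerm_nonneg {s : ℝ} (hs : 0 ≤ s) (k : ℕ) : 0 ≤ expTerm s k := by
  unfold expTerm; positivity

/-- kernel: |e_k(s)| ≤ e_k(R) for |s| ≤ R. [cite: Balaban1983Higgs3, (3.16) p.437] -/
theorem abs_expTerm_le {s R : ℝ} (h : |s| ≤ R) (k : ℕ) : |expTerm s k| ≤ expTerm R k := by
  unfold expTerm
  rw [abs_div, abs_pow, Nat.abs_cast]
  exact div_le_div_of_nonneg_right (pow_le_pow_left₀ (abs_nonneg s) h k) (by positivity)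

/-- kernel: the Bessel summand is e_j(s)·e_{j+n}(s). [cite: Balaban1983Higgs3, (3.16) p.437] -/
theorem besselTerm_eq (s : ℝ) (n j : ℕ) : besselTerm s n j = expTerm s j * expTerm s (j + n) := rfl

/-- e′_k: the derivative of e_k, namely e_{k−1} for k ≥ 1 and 0 for k = 0. [cite: Balaban1983Higgs3, (3.16) p.437] -/
def dExpTerm (s : ℝ) (k : ℕ) : ℝ := if k = 0 then 0 else expTerm s (k - 1)

/-- kernel: d/ds e_k(s) = e′_k(s). [cite: Balaban1983Higgs3, (3.16) p.437] -/
theorem hasDerivAt_expTerm (s : ℝ) (k : ℕ) : HasDerivAt (fun x => expTerm x k) (dExpTerm s k) s := by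
  unfold expTerm dExpTerm
  rcases Nat.eq_zero_or_pos k with hk | hk
  · subst hk
    simp only [pow_zero, Nat.factorial_zero, Nat.cast_one, div_one, if_true]
    exact hasDerivAt_const s 1
  · rw [if_neg (Nat.pos_iff_ne_zero.1 hk)]
    have h := (hasDerivAt_pow k s).div_const (k.factorial : ℝ)
    have hk' : (k : ℝ) * s ^ (k - 1) / k.factorial = s ^ (k - 1) / (k - 1).factorial := by
      obtain ⟨m, rfl⟩ : ∃ m, k = m + 1 := ⟨k - 1, by omega⟩
      simp only [Nat.add_sub_cancel, Nat.factorial_succ, Nat.cast_mul, Nat.cast_add, Nat.cast_one]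
      have hm : ((m.factorial : ℕ) : ℝ) ≠ 0 := by exact_mod_cast (Nat.factorial_pos m).ne'
      field_simp
    rw [hk'] at h
    exact h

/-- F′-summand: d/ds[e_j e_{j+n}] = e′_j e_{j+n} + e_j e′_{j+n}. [cite: Balaban1983Higgs3, (3.16) p.437] -/
def dBesselTerm (s : ℝ) (n j : ℕ) : ℝ := dExpTerm s j * expTerm s (j + n) + expTerm s j * dExpTerm s (j + n)

/-- kernel: the Bessel summand is differentiable in s with derivative `dBesselTerm`. [cite: Balaban1983Higgs3, (3.16) p.437] -/
theorem hasDerivAt_besselTerm (s : ℝ) (n j : ℕ) :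
    HasDerivAt (fun x => besselTerm x n j) (dBesselTerm s n j) s := by
  have h := (hasDerivAt_expTerm s j).mul (hasDerivAt_expTerm s (j + n))
  simp only [besselTerm_eq] at *
  exact h

/-- kernel: a uniform majorant of the derivative summand on |s| ≤ R: |e′_j e_{j+n} + e_j e′_{j+n}| ≤ the same at R.
[cite: Balaban1983Higgs3, (3.16) p.437] -/
theorem abs_dBesselTerm_le {s R : ℝ} (h : |s| ≤ R) (n j : ℕ) : |dBesselTerm s n j| ≤ dBesselTerm R n j := by
  have hR : 0 ≤ R := (abs_nonneg s).trans h
  have hd : ∀ k, |dExpTerm s k| ≤ dExpTerm R k := fun k => by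
    unfold dExpTerm
    split_ifs
    · simp
    · exact abs_expTerm_le h _
  have hdn : ∀ k, 0 ≤ dExpTerm R k := fun k => by
    unfold dExpTerm; split_ifs; exacts [le_rfl, expTerm_nonneg hR _]
  unfold dBesselTerm
  calc |dExpTerm s j * expTerm s (j + n) + expTerm s j * dExpTerm s (j + n)|
      ≤ |dExpTerm s j| * |expTerm s (j + n)| + |expTerm s j| * |dExpTerm s (j + n)| := by
        rw [← abs_mul, ← abs_mul]; exact abs_add_le _ _
    _ ≤ dExpTerm R j * expTerm R (j + n) + expTerm R j * dExpTerm R (j + n) :=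
        add_le_add (mul_le_mul (hd j) (abs_expTerm_le h _) (abs_nonneg _) (hdn j))
          (mul_le_mul (abs_expTerm_le h _) (hd _) (abs_nonneg _) (expTerm_nonneg hR _))

/-- kernel: the majorant series Σ_j dBesselTerm R n j converges (R ≥ 0): its two pieces are shifted Bessel series.
[cite: Balaban1983Higgs3, (3.16) p.437] -/
theorem summable_dBesselTerm {R : ℝ} (hR : 0 ≤ R) (n : ℕ) : Summable (dBesselTerm R n) := by
  -- piece 1: j ↦ e′_j(R) e_{j+n}(R) = [j ≥ 1] e_{j−1} e_{j+n} = besselTerm R (n+1) (j−1)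
  have h1 : Summable fun j => dExpTerm R j * expTerm R (j + n) := by
    have hs : Summable fun j => besselTerm R (n + 1) j := summable_besselTerm hR (n + 1)
    have hs' : Summable fun j => dExpTerm R (j + 1) * expTerm R (j + 1 + n) := by
      refine hs.congr fun j => ?_
      simp only [dExpTerm, Nat.succ_ne_zero, if_false, Nat.add_sub_cancel, besselTerm_eq]
      ring_nf
    exact (summable_nat_add_iff (f := fun j => dExpTerm R j * expTerm R (j + n)) 1).mp hs'
  -- piece 2: j ↦ e_j(R) e′_{j+n}(R)
  have h2 : Summable fun j => expTerm R j * dExpTerm R (j + n) := by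
    rcases Nat.eq_zero_or_pos n with hn | hn
    · subst hn
      have hs : Summable fun j => besselTerm R 1 j := summable_besselTerm hR 1
      have hs' : Summable fun j => expTerm R (j + 1) * dExpTerm R (j + 1 + 0) := by
        refine hs.congr fun j => ?_
        simp only [dExpTerm, add_zero, Nat.succ_ne_zero, if_false, Nat.add_sub_cancel, besselTerm_eq]
        ring
      exact (summable_nat_add_iff (f := fun j => expTerm R j * dExpTerm R (j + 0)) 1).mp hs'
    · have hs : Summable fun j => besselTerm R (n - 1) j := summable_besselTerm hR (n - 1)
      refine hs.congr fun j => ?_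
      have hne : j + n ≠ 0 := by omega
      simp only [dExpTerm, hne, if_false, besselTerm_eq]
      congr 2
      omega
  exact h1.add h2

/-- kernel: the derivative series sums to F(s,n+1) + F(s,|n−1|), i.e. Σ_j dBesselTerm s n j = F(s,n+1) + F(s,n−1) for n ≥ 1
and = 2F(s,1) for n = 0. [cite: Balaban1983Higgs3, (3.16) p.437] -/
theorem tsum_dBesselTerm {s : ℝ} (hs : 0 ≤ s) (n : ℕ) :
    ∑' j, dBesselTerm s n j = besselF s (n + 1) + besselF s ((n : ℤ) - 1).natAbs := by
  have h1 : HasSum (fun j => dExpTerm s j * expTerm s (j + n)) (besselF s (n + 1)) := by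
    have hs1 : HasSum (fun j => dExpTerm s (j + 1) * expTerm s (j + 1 + n)) (besselF s (n + 1)) := by
      refine (hasSum_besselF hs (n + 1)).congr_fun fun j => ?_
      simp only [dExpTerm, Nat.succ_ne_zero, if_false, Nat.add_sub_cancel, besselTerm_eq]
      ring_nf
    refine (hasSum_nat_add_iff' (f := fun j => dExpTerm s j * expTerm s (j + n)) (g := besselF s (n + 1)) 1).mp ?_
    rw [Finset.sum_range_one, show dExpTerm s 0 * expTerm s (0 + n) = 0 by simp [dExpTerm], sub_zero]
    exact hs1
  have h2 : HasSum (fun j => expTerm s j * dExpTerm s (j + n)) (besselF s ((n : ℤ) - 1).natAbs) := by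
    rcases Nat.eq_zero_or_pos n with hn | hn
    · subst hn
      have hs1 : HasSum (fun j => expTerm s (j + 1) * dExpTerm s (j + 1 + 0)) (besselF s 1) := by
        refine (hasSum_besselF hs 1).congr_fun fun j => ?_
        simp only [dExpTerm, add_zero, Nat.succ_ne_zero, if_false, Nat.add_sub_cancel, besselTerm_eq]
        ring
      have hidx : (((0 : ℕ) : ℤ) - 1).natAbs = 1 := by decide
      rw [hidx]
      refine (hasSum_nat_add_iff' (f := fun j => expTerm s j * dExpTerm s (j + 0)) (g := besselF s 1) 1).mp ?_
      rw [Finset.sum_range_one, show expTerm s 0 * dExpTerm s (0 + 0) = 0 by simp [dExpTerm], sub_zero]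
      exact hs1
    · have hidx : ((n : ℤ) - 1).natAbs = n - 1 := by omega
      rw [hidx]
      refine (hasSum_besselF hs (n - 1)).congr_fun fun j => ?_
      have hne : j + n ≠ 0 := by omega
      simp only [dExpTerm, hne, if_false, besselTerm_eq]
      congr 2
      omega
  exact (h1.add h2).tsum_eq

/-- **dF/ds**: s ↦ F(s,n) is differentiable on s > −1… precisely at every s ≥ 0… we prove it at every real s with |s| < R via
termwise differentiation; stated for s ≥ 0: HasDerivAt (F(·,n)) (F(s,n+1) + F(s,|n−1|)) s. [cite: Balaban1983Higgs3, (3.16) p.437] -/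
theorem hasDerivAt_besselF {s : ℝ} (hs : 0 ≤ s) (n : ℕ) :
    HasDerivAt (fun x => besselF x n) (besselF s (n + 1) + besselF s ((n : ℤ) - 1).natAbs) s := by
  set R : ℝ := s + 1 with hR
  have hRpos : 0 ≤ R := by rw [hR]; linarith
  have hmem : s ∈ Set.Ioo (-R) R := by rw [hR]; constructor <;> linarith
  have h := hasDerivAt_tsum_of_isPreconnected (u := dBesselTerm R n) (g := fun j x => besselTerm x n j)
    (g' := fun j x => dBesselTerm x n j) (t := Set.Ioo (-R) R) (y₀ := s) (summable_dBesselTerm hRpos n) isOpen_Ioo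
    (isPreconnected_Ioo) (fun j x _ => hasDerivAt_besselTerm x n j)
    (fun j x hx => by
      rw [Real.norm_eq_abs]
      exact abs_dBesselTerm_le (abs_le.2 ⟨hx.1.le, hx.2.le⟩) n j)
    hmem (summable_besselTerm hs n) hmem
  rw [tsum_dBesselTerm hs n] at h
  exact h

/-! ## 2. The separated-variables kernel Q(s)(y) = Π_μ F(s, |y_μ|) and its "heat equation" dQ/ds = H Q -/

/-- The one-dimensional kernel on ℤ: G(s,n) = F(s,|n|). [cite: Balaban1983Higgs3, (3.16) p.437] -/
def G (s : ℝ) (n : ℤ) : ℝ := besselF s n.natAbs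

/-- kernel: dG(s,n)/ds = G(s,n+1) + G(s,n−1) (the one-dimensional lattice "heat equation" of the continuous-time walk).
[cite: Balaban1983Higgs3, (3.16) p.437] -/
theorem hasDerivAt_G {s : ℝ} (hs : 0 ≤ s) (n : ℤ) :
    HasDerivAt (fun x => G x n) (G s (n + 1) + G s (n - 1)) s := by
  unfold G
  have h := hasDerivAt_besselF hs n.natAbs
  rcases le_or_gt 0 n with hn | hn
  · have h1 : (n + 1).natAbs = n.natAbs + 1 := by omega
    have h2 : (n - 1).natAbs = ((n.natAbs : ℤ) - 1).natAbs := by omega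
    rw [h1, h2]
    exact h
  · have h1 : (n - 1).natAbs = n.natAbs + 1 := by omega
    have h2 : (n + 1).natAbs = ((n.natAbs : ℤ) - 1).natAbs := by omega
    rw [h1, h2, add_comm]
    exact h

/-- kernel: G ≥ 0 for s ≥ 0. [cite: Balaban1983Higgs3, (3.16) p.437] -/
theorem G_nonneg {s : ℝ} (hs : 0 ≤ s) (n : ℤ) : 0 ≤ G s n := besselF_nonneg hs _

/-- kernel: G(s,n) ≤ e^{2s} for s ≥ 0. [cite: Balaban1983Higgs3, (3.16) p.437] -/
theorem G_le {s : ℝ} (hs : 0 ≤ s) (n : ℤ) : G s n ≤ Real.exp (2 * s) := besselF_le_exp_two_mul hs _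

/-- kernel: G(0,n) = [n = 0]. [cite: Balaban1983Higgs3, (3.16) p.437] -/
theorem G_zero_left (n : ℤ) : G 0 n = if n = 0 then 1 else 0 := by
  unfold G
  rw [besselF_zero_left]
  simp [Int.natAbs_eq_zero]

/-- The separated-variables kernel Q(s)(y) = Π_μ G(s, y_μ) on ℤ^d (the Poissonized d-dimensional walk kernel e^{sH}δ₀(y)).
[cite: Balaban1983Higgs3, (3.16) p.437] -/
def Q (s : ℝ) (y : ZSite d) : ℝ := ∏ μ : Fin d, G s (y μ)

/-- kernel: Q ≥ 0 (s ≥ 0). [cite: Balaban1983Higgs3, (3.16) p.437] -/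
theorem Q_nonneg {s : ℝ} (hs : 0 ≤ s) (y : ZSite d) : 0 ≤ Q s y :=
  Finset.prod_nonneg fun _ _ => G_nonneg hs _

/-- kernel: Q(s)(y) ≤ e^{2ds} (s ≥ 0). [cite: Balaban1983Higgs3, (3.16) p.437] -/
theorem Q_le {s : ℝ} (hs : 0 ≤ s) (y : ZSite d) : Q s y ≤ Real.exp (2 * d * s) := by
  unfold Q
  calc ∏ μ : Fin d, G s (y μ) ≤ ∏ _μ : Fin d, Real.exp (2 * s) :=
        Finset.prod_le_prod (fun μ _ => G_nonneg hs _) fun μ _ => G_le hs _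
    _ = Real.exp (2 * d * s) := by
        rw [Finset.prod_const, Finset.card_univ, Fintype.card_fin, ← Real.exp_nat_mul]; ring_nf

/-- kernel: Q(0) = δ₀. [cite: Balaban1983Higgs3, (3.16) p.437] -/
theorem Q_zero_left (y : ZSite d) : Q 0 y = if y = 0 then 1 else 0 := by
  unfold Q
  simp_rw [G_zero_left]
  by_cases hy : y = 0
  · subst hy; simp
  · rw [if_neg hy]
    obtain ⟨μ, hμ⟩ : ∃ μ, y μ ≠ 0 := by
      by_contra h
      push Not at h
      exact hy (funext h)
    exact Finset.prod_eq_zero (Finset.mem_univ μ) (if_neg hμ)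

/-- kernel: a shifted site agrees with the original off the shifted coordinate. [folklore] -/
private theorem shift_apply_of_ne (y : ZSite d) (μ ν : Fin d) (h : ν ≠ μ) (c : ℤ) :
    (y + c • unitVec μ) ν = y ν := by
  simp [unitVec, Pi.single_eq_of_ne h]

/-- kernel: Q at a shifted site y ± e_μ factors as G(s, y_μ ± 1)·Π_{ν≠μ} G(s, y_ν). [cite: Balaban1983Higgs3, (3.16) p.437] -/
theorem Q_shift (s : ℝ) (y : ZSite d) (μ : Fin d) (c : ℤ) :
    Q s (y + c • unitVec μ) = G s (y μ + c) * ∏ ν ∈ Finset.univ.erase μ, G s (y ν) := by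
  unfold Q
  rw [← Finset.mul_prod_erase Finset.univ (fun ν => G s ((y + c • unitVec μ) ν)) (Finset.mem_univ μ)]
  congr 1
  · simp [unitVec]
  · exact Finset.prod_congr rfl fun ν hν => by rw [shift_apply_of_ne y μ ν (Finset.ne_of_mem_erase hν) c]

/-- kernel (**the heat equation of the product kernel**): dQ(s)(y)/ds = (HQ(s))(y) = Σ_μ [Q(s)(y+e_μ) + Q(s)(y−e_μ)].
[cite: Balaban1983Higgs3, (3.16) p.437] -/
theorem hasDerivAt_Q {s : ℝ} (hs : 0 ≤ s) (y : ZSite d) : HasDerivAt (fun x => Q x y) (hop (Q s) y) s := by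
  have h := HasDerivAt.fun_finsetProd (u := Finset.univ) (f := fun μ x => G x (y μ))
    (f' := fun μ => G s (y μ + 1) + G s (y μ - 1)) (x := s) fun μ _ => hasDerivAt_G hs (y μ)
  have heq : hop (Q s) y =
      ∑ μ ∈ Finset.univ, (∏ ν ∈ Finset.univ.erase μ, G s (y ν)) • (G s (y μ + 1) + G s (y μ - 1)) := by
    unfold hop
    refine Finset.sum_congr rfl fun μ _ => ?_
    have h1 := Q_shift s y μ 1
    have h2 := Q_shift s y μ (-1)
    rw [one_smul] at h1
    rw [neg_one_smul, ← sub_eq_add_neg] at h2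
    rw [h1, h2, smul_eq_mul]
    ring
  rw [heq]
  exact h

/-- kernel: (HQ(s))(y) ≥ 0. [cite: Balaban1983Higgs3, (3.16) p.437] -/
theorem hop_Q_nonneg {s : ℝ} (hs : 0 ≤ s) (y : ZSite d) : 0 ≤ hop (Q s) y :=
  Finset.sum_nonneg fun _ _ => add_nonneg (Q_nonneg hs _) (Q_nonneg hs _)

/-- kernel: (HQ(s))(y) ≤ 2d·e^{2ds}. [cite: Balaban1983Higgs3, (3.16) p.437] -/
theorem hop_Q_le {s : ℝ} (hs : 0 ≤ s) (y : ZSite d) : hop (Q s) y ≤ 2 * d * Real.exp (2 * d * s) := by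
  unfold hop
  calc ∑ μ : Fin d, (Q s (y + unitVec μ) + Q s (y - unitVec μ))
      ≤ ∑ _μ : Fin d, (Real.exp (2 * d * s) + Real.exp (2 * d * s)) :=
        Finset.sum_le_sum fun μ _ => add_le_add (Q_le hs _) (Q_le hs _)
    _ = 2 * d * Real.exp (2 * d * s) := by
        rw [Finset.sum_const, Finset.card_univ, Fintype.card_fin, nsmul_eq_mul]; ring

/-! ## 3. The Poissonized kernel K(y) = θξ²ξ^{−d}∫₀^∞ e^{−t} Q(θt)(y) dt solves the lattice equation -/

/-- kernel: θ = (2d+ξ²)^{−1} > 0. [folklore] -/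
private theorem theta_pos (hξ : 0 < ξ) : 0 < hopWeight d ξ := by
  unfold hopWeight; positivity

/-- kernel: 1 − 2dθ = θξ² (so e^{−t}e^{2dθt} = e^{−θξ²t}). [folklore] -/
private theorem one_sub_rho (hξ : 0 < ξ) : 1 - 2 * d * hopWeight d ξ = hopWeight d ξ * ξ ^ 2 := by
  unfold hopWeight
  have hne : (2 * d + ξ ^ 2 : ℝ) ≠ 0 := by positivity
  field_simp
  ring

/-- The integrand e^{−t}Q(θt)(y) of the Poissonized kernel. [cite: Balaban1983Higgs3, (3.16) p.437] -/
def integrand (d : ℕ) (ξ : ℝ) (y : ZSite d) (t : ℝ) : ℝ := Real.exp (-t) * Q (hopWeight d ξ * t) y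

/-- **The Poissonized kernel** K(y) = θξ²·ξ^{−d}·∫₀^∞ e^{−t} Π_μ F(θt, |y_μ|) dt. [cite: Balaban1983Higgs3, (3.16) p.437] -/
def poissonK (d : ℕ) (ξ : ℝ) (y : ZSite d) : ℝ :=
  hopWeight d ξ * ξ ^ 2 * ξ⁻¹ ^ d * ∫ t in Ioi (0 : ℝ), integrand d ξ y t

/-- kernel: the derivative in t of the integrand: d/dt[e^{−t}Q(θt)(y)] = e^{−t}(θ·(HQ(θt))(y) − Q(θt)(y)) for t ≥ 0.
[cite: Balaban1983Higgs3, (3.16) p.437] -/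
theorem hasDerivAt_integrand (hξ : 0 < ξ) (y : ZSite d) {t : ℝ} (ht : 0 ≤ t) :
    HasDerivAt (integrand d ξ y)
      (Real.exp (-t) * (hopWeight d ξ * hop (Q (hopWeight d ξ * t)) y - Q (hopWeight d ξ * t) y)) t := by
  have hθ := theta_pos (d := d) hξ
  have hQ' : HasDerivAt (fun x => Q (hopWeight d ξ * x) y) (hop (Q (hopWeight d ξ * t)) y * hopWeight d ξ) t := by
    have h1 : HasDerivAt (fun x => hopWeight d ξ * x) (hopWeight d ξ) t := by
      simpa using (hasDerivAt_id t).const_mul (hopWeight d ξ)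
    have h2 := hasDerivAt_Q (d := d) (s := hopWeight d ξ * t) (by positivity) y
    exact h2.comp t h1
  have hE : HasDerivAt (fun x => Real.exp (-x)) (-Real.exp (-t)) t := by
    simpa using (hasDerivAt_neg t).exp
  unfold integrand
  refine (hE.mul hQ').congr_deriv ?_
  ring

/-- kernel: 0 ≤ e^{−t}Q(θt)(y) ≤ e^{−θξ²t} for t ≥ 0. [cite: Balaban1983Higgs3, (3.16) p.437] -/
theorem integrand_le (hξ : 0 < ξ) (y : ZSite d) {t : ℝ} (ht : 0 ≤ t) :
    integrand d ξ y t ≤ Real.exp (-(hopWeight d ξ * ξ ^ 2) * t) := by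
  have hθ := theta_pos (d := d) hξ
  unfold integrand
  calc Real.exp (-t) * Q (hopWeight d ξ * t) y ≤ Real.exp (-t) * Real.exp (2 * d * (hopWeight d ξ * t)) :=
        mul_le_mul_of_nonneg_left (Q_le (by positivity) y) (Real.exp_pos _).le
    _ = Real.exp (-(hopWeight d ξ * ξ ^ 2) * t) := by
        rw [← Real.exp_add, ← one_sub_rho (d := d) hξ]
        congr 1
        ring

/-- kernel: e^{−t}Q(θt)(y) ≥ 0 for t ≥ 0. [cite: Balaban1983Higgs3, (3.16) p.437] -/
theorem integrand_nonneg (hξ : 0 < ξ) (y : ZSite d) {t : ℝ} (ht : 0 ≤ t) : 0 ≤ integrand d ξ y t :=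
  mul_nonneg (Real.exp_pos _).le (Q_nonneg (mul_nonneg (theta_pos (d := d) hξ).le ht) y)

/-- kernel: continuity of t ↦ Q(θt)(y) on t ≥ 0 (it is differentiable there). [cite: Balaban1983Higgs3, (3.16) p.437] -/
theorem continuousOn_Q (hξ : 0 < ξ) (y : ZSite d) : ContinuousOn (fun t => Q (hopWeight d ξ * t) y) (Ici 0) := by
  intro t ht
  have h1 : HasDerivAt (fun x => hopWeight d ξ * x) (hopWeight d ξ) t := by
    simpa using (hasDerivAt_id t).const_mul (hopWeight d ξ)
  have h2 := hasDerivAt_Q (d := d) (s := hopWeight d ξ * t) (mul_nonneg (theta_pos (d := d) hξ).le ht) y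
  exact (h2.comp t h1).continuousAt.continuousWithinAt

/-- kernel: the integrand is integrable on (0, ∞) (dominated by e^{−θξ²t}). [cite: Balaban1983Higgs3, (3.16) p.437] -/
theorem integrableOn_integrand (hξ : 0 < ξ) (y : ZSite d) : IntegrableOn (integrand d ξ y) (Ioi 0) := by
  have hb : 0 < hopWeight d ξ * ξ ^ 2 := mul_pos (theta_pos hξ) (pow_pos hξ 2)
  have hg : IntegrableOn (fun t => Real.exp (-(hopWeight d ξ * ξ ^ 2) * t)) (Ioi 0) := exp_neg_integrableOn_Ioi 0 hb
  refine Integrable.mono' hg ?_ ?_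
  · refine ContinuousOn.aestronglyMeasurable ?_ measurableSet_Ioi
    exact ((Real.continuous_exp.comp continuous_neg).continuousOn.mul
      ((continuousOn_Q hξ y).mono Ioi_subset_Ici_self))
  · refine (ae_restrict_iff' measurableSet_Ioi).2 (ae_of_all _ fun t (ht : 0 < t) => ?_)
    rw [Real.norm_eq_abs, abs_of_nonneg (integrand_nonneg hξ y ht.le)]
    exact integrand_le hξ y ht.le

/-- kernel: the hopping sum of the integrand is integrable on (0, ∞) as well (dominated by 2d·e^{−θξ²t}).
[cite: Balaban1983Higgs3, (3.16) p.437] -/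
theorem integrableOn_hop_integrand (hξ : 0 < ξ) (y : ZSite d) :
    IntegrableOn (fun t => Real.exp (-t) * hop (Q (hopWeight d ξ * t)) y) (Ioi 0) := by
  have h : (fun t => Real.exp (-t) * hop (Q (hopWeight d ξ * t)) y) =
      fun t => ∑ μ : Fin d, (integrand d ξ (y + unitVec μ) t + integrand d ξ (y - unitVec μ) t) := by
    funext t
    unfold hop integrand
    rw [Finset.mul_sum]
    exact Finset.sum_congr rfl fun μ _ => by ring
  rw [h]
  exact integrable_finsetSum _ fun μ _ =>
    (integrableOn_integrand hξ (y + unitVec μ)).add (integrableOn_integrand hξ (y - unitVec μ))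

/-- kernel: the t-derivative of the integrand is integrable on (0, ∞). [cite: Balaban1983Higgs3, (3.16) p.437] -/
theorem integrableOn_deriv_integrand (hξ : 0 < ξ) (y : ZSite d) :
    IntegrableOn (fun t => Real.exp (-t) * (hopWeight d ξ * hop (Q (hopWeight d ξ * t)) y - Q (hopWeight d ξ * t) y))
      (Ioi 0) := by
  have h : (fun t => Real.exp (-t) * (hopWeight d ξ * hop (Q (hopWeight d ξ * t)) y - Q (hopWeight d ξ * t) y)) =
      fun t => hopWeight d ξ * (Real.exp (-t) * hop (Q (hopWeight d ξ * t)) y) - integrand d ξ y t := by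
    funext t; unfold integrand; ring
  rw [h]
  exact ((integrableOn_hop_integrand hξ y).const_mul _).sub (integrableOn_integrand hξ y)

/-- kernel: e^{−t}Q(θt)(y) → 0 as t → ∞. [cite: Balaban1983Higgs3, (3.16) p.437] -/
theorem tendsto_integrand (hξ : 0 < ξ) (y : ZSite d) : Tendsto (integrand d ξ y) atTop (𝓝 0) := by
  have hb : 0 < hopWeight d ξ * ξ ^ 2 := mul_pos (theta_pos hξ) (pow_pos hξ 2)
  have hg : Tendsto (fun t => Real.exp (-(hopWeight d ξ * ξ ^ 2) * t)) atTop (𝓝 0) := by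
    have h1 : Tendsto (fun t => (hopWeight d ξ * ξ ^ 2) * t) atTop atTop := tendsto_id.const_mul_atTop hb
    have h2 := Real.tendsto_exp_neg_atTop_nhds_zero.comp h1
    refine h2.congr fun t => ?_
    simp only [Function.comp_apply]; ring_nf
  refine squeeze_zero_norm' ?_ hg
  filter_upwards [eventually_ge_atTop (0 : ℝ)] with t ht
  rw [Real.norm_eq_abs, abs_of_nonneg (integrand_nonneg hξ y ht)]
  exact integrand_le hξ y ht

/-- kernel (integration by parts on [0, ∞)): ∫₀^∞ e^{−t}(θ·(HQ(θt))(y) − Q(θt)(y)) dt = −δ₀(y).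
[cite: Balaban1983Higgs3, (3.16) p.437] -/
theorem integral_deriv_integrand (hξ : 0 < ξ) (y : ZSite d) :
    ∫ t in Ioi (0 : ℝ), Real.exp (-t) * (hopWeight d ξ * hop (Q (hopWeight d ξ * t)) y - Q (hopWeight d ξ * t) y) =
      -(if y = 0 then 1 else 0) := by
  have h := integral_Ioi_of_hasDerivAt_of_tendsto' (a := 0) (f := integrand d ξ y) (m := 0)
    (fun t ht => hasDerivAt_integrand hξ y ht) (integrableOn_deriv_integrand hξ y) (tendsto_integrand hξ y)
  rw [h]
  unfold integrand
  rw [mul_zero, Q_zero_left, neg_zero, Real.exp_zero, one_mul, zero_sub]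

/-- kernel: the hopping sum commutes with the t-integral: (HK)(y) = θξ²ξ^{−d}∫₀^∞ e^{−t}(HQ(θt))(y) dt.
[cite: Balaban1983Higgs3, (3.16) p.437] -/
theorem hop_poissonK (hξ : 0 < ξ) (y : ZSite d) :
    hop (poissonK d ξ) y =
      hopWeight d ξ * ξ ^ 2 * ξ⁻¹ ^ d * ∫ t in Ioi (0 : ℝ), Real.exp (-t) * hop (Q (hopWeight d ξ * t)) y := by
  have h : (fun t => Real.exp (-t) * hop (Q (hopWeight d ξ * t)) y) =
      fun t => ∑ μ : Fin d, (integrand d ξ (y + unitVec μ) t + integrand d ξ (y - unitVec μ) t) := by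
    funext t
    unfold hop integrand
    rw [Finset.mul_sum]
    exact Finset.sum_congr rfl fun μ _ => by ring
  have hf : ∀ μ ∈ (Finset.univ : Finset (Fin d)),
      Integrable (fun t => integrand d ξ (y + unitVec μ) t + integrand d ξ (y - unitVec μ) t)
        (volume.restrict (Ioi (0 : ℝ))) := fun μ _ =>
    (integrableOn_integrand hξ (y + unitVec μ)).add (integrableOn_integrand hξ (y - unitVec μ))
  rw [h, integral_finsetSum Finset.univ hf]
  unfold hop poissonK
  rw [Finset.mul_sum]
  refine Finset.sum_congr rfl fun μ _ => ?_
  rw [integral_add (integrableOn_integrand hξ _) (integrableOn_integrand hξ _)]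
  ring

/-- **The Poissonized kernel solves the lattice equation** in r15's fixed-point form: K = θ·HK + θξ²·ξ^{−d}1_{0}
(integration by parts against e^{−t} of the heat equation dQ(θt)/dt = θ·HQ(θt), with Q(0) = δ₀). [cite: Balaban1983Higgs3, (3.16) p.437] -/
theorem poissonK_fixedPoint (hξ : 0 < ξ) (y : ZSite d) :
    poissonK d ξ y = hopWeight d ξ * hop (poissonK d ξ) y + hopWeight d ξ * ξ ^ 2 * (if y = 0 then ξ⁻¹ ^ d else 0) := by
  have hI := integral_deriv_integrand hξ y
  have hsplit : ∫ t in Ioi (0 : ℝ), Real.exp (-t) * (hopWeight d ξ * hop (Q (hopWeight d ξ * t)) y - Q (hopWeight d ξ * t) y)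
      = hopWeight d ξ * (∫ t in Ioi (0 : ℝ), Real.exp (-t) * hop (Q (hopWeight d ξ * t)) y) -
        ∫ t in Ioi (0 : ℝ), integrand d ξ y t := by
    have h : (fun t => Real.exp (-t) * (hopWeight d ξ * hop (Q (hopWeight d ξ * t)) y - Q (hopWeight d ξ * t) y)) =
        fun t => hopWeight d ξ * (Real.exp (-t) * hop (Q (hopWeight d ξ * t)) y) - integrand d ξ y t := by
      funext t; unfold integrand; ring
    rw [h, integral_sub ((integrableOn_hop_integrand hξ y).const_mul _) (integrableOn_integrand hξ y), integral_const_mul]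
  rw [hsplit] at hI
  rw [hop_poissonK hξ y]
  unfold poissonK
  have hK : ∫ t in Ioi (0 : ℝ), integrand d ξ y t =
      hopWeight d ξ * (∫ t in Ioi (0 : ℝ), Real.exp (-t) * hop (Q (hopWeight d ξ * t)) y) + (if y = 0 then 1 else 0) := by
    linarith
  rw [hK]
  split_ifs <;> ring

/-! ## 4. Identification with C^ξ by r15's uniqueness theorem -/

/-- kernel: the Poissonized kernel is bounded (0 ≤ K ≤ θξ²ξ^{−d}∫₀^∞ e^{−θξ²t}dt). [cite: Balaban1983Higgs3, (3.16) p.437] -/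
theorem abs_poissonK_le (hξ : 0 < ξ) (y : ZSite d) :
    |poissonK d ξ y| ≤ hopWeight d ξ * ξ ^ 2 * ξ⁻¹ ^ d *
      ∫ t in Ioi (0 : ℝ), Real.exp (-(hopWeight d ξ * ξ ^ 2) * t) := by
  have hθ := theta_pos (d := d) hξ
  have hb : 0 < hopWeight d ξ * ξ ^ 2 := mul_pos hθ (pow_pos hξ 2)
  have hC : 0 ≤ hopWeight d ξ * ξ ^ 2 * ξ⁻¹ ^ d := by positivity
  have hint : 0 ≤ ∫ t in Ioi (0 : ℝ), integrand d ξ y t :=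
    setIntegral_nonneg measurableSet_Ioi fun t ht => integrand_nonneg hξ y (le_of_lt ht)
  unfold poissonK
  rw [abs_of_nonneg (mul_nonneg hC hint)]
  refine mul_le_mul_of_nonneg_left ?_ hC
  refine setIntegral_mono_on (integrableOn_integrand hξ y) (exp_neg_integrableOn_Ioi 0 hb) measurableSet_Ioi ?_
  intro t ht
  exact integrand_le hξ y (le_of_lt ht)

/-- kernel: the hopping sum is additive. [folklore] -/
private theorem hop_sub (f g : ZSite d → ℝ) (y : ZSite d) : hop (fun z => f z - g z) y = hop f y - hop g y := by
  unfold hop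
  rw [← Finset.sum_sub_distrib]
  exact Finset.sum_congr rfl fun μ _ => by ring

/-- **POISSONIZATION / SEPARATION OF VARIABLES: C^ξ(y) = θξ²·ξ^{−d}·∫₀^∞ e^{−t} Π_μ F(θt, |y_μ|) dt** (θ = (2d+ξ²)^{−1}, F the
one-dimensional Bessel kernel of `B3CxiBesselKernel`): both sides are bounded solutions of the fixed-point form of the lattice
equation (−Δ^ξ+1)C = δ^ξ, and bounded solutions are unique (r15's `B3CxiPropagator.eq_zero_of_hop_fixedPoint`).
[cite: Balaban1983Higgs3, (3.16) p.437] -/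
theorem Cxi_eq_poissonK (hξ : 0 < ξ) (y : ZSite d) : Cxi d ξ y = poissonK d ξ y := by
  set M : ℝ := ξ⁻¹ ^ d + hopWeight d ξ * ξ ^ 2 * ξ⁻¹ ^ d *
    ∫ t in Ioi (0 : ℝ), Real.exp (-(hopWeight d ξ * ξ ^ 2) * t) with hM
  have h := eq_zero_of_hop_fixedPoint hξ (e := fun z => Cxi d ξ z - poissonK d ξ z) (M := M)
    (fun z => (abs_sub _ _).trans (add_le_add (abs_Cxi_le hξ z) (abs_poissonK_le hξ z)))
    (fun z => by
      have h1 : Cxi d ξ z = hopWeight d ξ * hop (Cxi d ξ) z + hopWeight d ξ * ξ ^ 2 * (if z = 0 then ξ⁻¹ ^ d else 0) := by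
        have := neumannK_fixedPoint hξ z
        have hfun : (Cxi d ξ : ZSite d → ℝ) = neumannK d ξ := funext fun w => Cxi_eq_neumannK hξ w
        rw [hfun]
        exact this
      have h2 := poissonK_fixedPoint hξ z
      rw [hop_sub]
      linarith)
    y
  linarith

/-- **C^ξ(y) = θξ²·ξ^{−d}·∫₀^∞ e^{−t} Π_μ F(θt,|y_μ|) dt**, unfolded. [cite: Balaban1983Higgs3, (3.16) p.437] -/
theorem Cxi_eq_integral (hξ : 0 < ξ) (y : ZSite d) :
    Cxi d ξ y = hopWeight d ξ * ξ ^ 2 * ξ⁻¹ ^ d *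
      ∫ t in Ioi (0 : ℝ), Real.exp (-t) * ∏ μ : Fin d, besselF (hopWeight d ξ * t) (y μ).natAbs := by
  rw [Cxi_eq_poissonK hξ y]
  rfl

end

end Literature.MathematicalPhysics.QuantumFieldTheory.Balaban1983to89.B3CxiPoissonization
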